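import Summits.QuantumFields.BalabanUV.Beta.RemainderExplicitHistoryDiagonalTwoRun

/-!
# RemainderExplicitHistoryDiagonalSource — ROAD P3, STATION S-d4p3-g48-1, THIRD FILE: THE EXTRA-HISTORY SOURCE OF ONE BOX RUN IS
# `≍ Σ_a ρ(a)·min(a,K)² ∕ (K√K)` — an age `a` is missing from the short run at exactly the `min(a,K)` ultraviolet-most positions, where
# asymptotic freedom makes the couplings `≍ (K−j)^{−1∕2}` and an age-`a` gap `≍ (K−j)^{−1∕2}·min(1, a∕(K−j))` (BOTH WAYS: floor `b`, ceiling
# `b + Wγ`); young ages `a ≤ K∕2` therefore cost `a²∕K^{3∕2}`, old ages `√K` — the first moment of `ρ` never enters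

Cell `pub-balaban`, β-function sub-cell, BINDER row D4 «RemainderConst leaves for Bałaban's split» (`HOME/BINDER-OWNERS.md`; owner
lineage `b2b-balaban-beta-an4`; this file by co-owner #3 lineage `b2b-balaban-beta-d4-p3`, road P3 «the reduction road», generation 48,
station S-d4p3-g48-1 «the cutoff discrepancy of the continuum coupling: two-sided law», third file; imports the station's second file
`RemainderExplicitHistoryDiagonalTwoRun`), β-FLOW TEAM duty (1);
FREEZE (0) honoured (def-free module in road P3's own `RemainderExplicit*` series; no leaf, no interface, no Literature file).  SOURCE
OF THE SHAPES ONLY: [Balaban1987RG1] (0.20) p. 256, (0.31) and Thm 2 p. 259, §5 p. 298.  Pure real analysis.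

HONEST FRAMING (page 1 of everything the β sub-cell writes).  *"Discharging BetaPertH makes Bałaban's UV stability UNCONDITIONAL —
a real constructive-QFT result; it is NOT the continuum limit and NOT the Clay problem."*  THIS FILE DISCHARGES NOTHING OF THE
KIND.  It is [folklore] real analysis about ONE explicit toy family (ours), road P3's ORDER-0 PROFILE FAMILY
`β_{k+1} = b + Σ_{i≤k} ρ(k−i)·min(g_k, |g_k − g_i|)` (generation 44), whose memory PROFILE `ρ ≥ 0` is merely summable (`Σ_{a<N} ρ_a ≤ W`).
Nothing of Bałaban's (1.22) is asserted or constructed; row D4 class UNCHANGED (critical-path width 0; instance 0∕1; D4 DISCHARGE NO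
DATE); NOT B12 Thm 2, NOT BetaPertH, NOT continuum, NOT Clay.  HONEST DEPENDENCY: continuum YM on T⁴ ⇐ BetaPertH ∧ nine spine
estimates (0/9 proved); BetaPertH ⇐ (D1) ∧ (D4) ∧ CAP+tail; G-an2-4 gates asym, D1 and NE2/3/4.  ABSOLUTE RULE: nothing is cited as a
fact.  All letters NOT-IN-PRINT; `BetaFlowAsPrinted S` records a Markov β_n only ⇒ no junction of the as-printed interface changes.

THE STATION'S QUESTION (generation 47's census, `RemainderExplicitHistoryDiagonalMonotone.hasSum_disc`): for a pinned family of runs the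
diagonal discrepancy series has sum `Q(m) := astar g m − invSq g m 0` (continuum recursion variable `m` scales above the pin MINUS the
ultraviolet end of the run with exactly `m` steps); WHEN is `sup_m Q(m) < ∞`?  Generation 47 conjectured «iff `Σ_a a·ρ(a) < ∞`» from numerics.
THE STATION'S ANSWER: `Q(m) ≍ m^{−3∕2}·Σ_a ρ(a)·min(a,m)²` (two-sided — the lower side for the running maximum `max_{m′≤m} Q(m′)` —
with constants in `b, γ, W, g_IR`; the upper side under `Wγ < b`), so `sup_m Q(m) < ∞` iff `Σ_a ρ(a)·min(a,m)² = O(m^{3∕2})`; a bounded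
HALF moment `Σ_a ρ(a)√a` suffices (the first moment is not needed and even gives decay `O(m^{−1∕2})`); for `ρ(a) ≍ a^{−p}` the criterion
reads `p ≥ 3∕2` (kernel text: the borderline `p = 3∕2` and a sparse violating profile in the annex `…DiagonalExamples`, `p > 3∕2` through
the half moment) — the conjectured first-moment threshold `p > 2` is not the true one.

WHAT IS PROVED HERE ([folklore]; 0 sorry; 0 `def`; one box run `g` of `K + n` steps of the family; `κ = (b+Wγ)∕b`, `b₂ = 1∕(g_{K+n})² + b + Wγ`,
`κ₂ = b₂∕b`).
* §1 `beta_le_ceiling` (`β ≤ b + Wγ` on the box), **`inv_sq_between`** (`1∕(g_l)² + b(l−i) ≤ 1∕(g_i)² ≤ 1∕(g_l)² + (b+Wγ)(l−i)` for `i ≤ l`),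
  `coupling_le_inv_sqrt` (`g_{j+n} ≤ (b(K−j))^{−1∕2}`, `T4OneLoopAsymptotics.run_le_inv_sqrt` BY NAME), `inv_sqrt_le_coupling`
  (`(b₂(K−j))^{−1∕2} ≤ g_{j+n}` for `j < K`).
* §2 **`gap_le_profile_min`** (`g_{j+n} − g_{j+n−a} ≤ (b(K−j))^{−1∕2}·min(1, κa∕(2(K−j)))`), **`profile_min_le_gap`**
  (`(1∕8)(b₂(K−j))^{−1∕2}·min(1, a∕(κ₂(K−j))) ≤ g_{j+n} − g_{j+n−a}`).
* §3 `src_eq_sum_ages`; **`src_le`** (`src ≤ (8κ∕(K√(bK)))·Σ_{a<K+n} ρ(a)·min(a,K)²`); **`le_src`** (`(1∕(8κ₂K√(b₂K)))·Σ_{a<N} ρ(a)·min(a,K)² ≤ src`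
  for every `N ≤ n + 1`).
-/

noncomputable section

open Finset

namespace Summit.QuantumFields.BalabanUV.Beta.RemainderExplicitHistoryDiagonalSource

open Literature.MathematicalPhysics.QuantumFieldTheory.Balaban1983to89
open Literature.MathematicalPhysics.QuantumFieldTheory.Balaban1983to89.FlowStep
open Literature.MathematicalPhysics.QuantumFieldTheory.Balaban1983to89.T4CouplingMatching
open Literature.MathematicalPhysics.QuantumFieldTheory.Balaban1983to89.T4OneLoopAsymptotics
open Summit.QuantumFields.BalabanUV.Beta.RemainderExplicitHistoryHalfMoment (mul_min_mono)
open Summit.QuantumFields.BalabanUV.Beta.RemainderExplicitHistoryDiagonalProfile (sum_fin_profile_eq)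
open Summit.QuantumFields.BalabanUV.Beta.RemainderExplicitHistoryDiagonalMonotone
open Summit.QuantumFields.BalabanUV.Beta.RemainderExplicitHistoryDiagonalWeights

variable {β : HBeta} {b γ W : ℝ} {ρ : ℕ → ℝ}

/-! ## §1 One box run of the family: the ceiling `b + Wγ`, two-sided (0.31) between two scales, the coupling profile both ways -/

/-- THE CEILING ON THE BOX: `β ≤ b + W·γ` (the history term is at most `W·p_k ≤ W·γ`, generation 44's `hist_le`). [folklore] -/
theorem beta_le_ceiling
    (hβ : ∀ (k : ℕ) (p : Fin (k + 1) → ℝ),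
      β k p = b + ∑ i : Fin (k + 1), ρ (k - i) * min (p (Fin.last k)) (|p (Fin.last k) - p i|))
    (hρ0 : ∀ a, 0 ≤ ρ a) (hρW : ∀ n, ∑ a ∈ range n, ρ a ≤ W) (k : ℕ) (p : Fin (k + 1) → ℝ) (hp : p ∈ Box γ k) :
    β k p ≤ b + W * γ := by
  have hW : 0 ≤ W := by simpa using hρW 0
  have hlamW : ∀ k, ∑ i : Fin (k + 1), (fun k i => ρ (k - i)) k i ≤ W := fun k => by
    simpa [sum_fin_profile_eq] using hρW (k + 1)
  have h1 := RemainderExplicitHistoryHalfMomentWitness.hist_le (γ := γ) (lam := fun k i => ρ (k - i)) (fun k i => hρ0 _) hlamW hp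
  have h2 : W * p (Fin.last k) ≤ W * γ := mul_le_mul_of_nonneg_left (mem_box.mp hp _).2 hW
  rw [hβ k p]
  linarith

/-- TWO-SIDED (0.31) BETWEEN TWO SCALES OF ONE BOX RUN: for `i ≤ l ≤ L`,
`1∕(g_l)² + b·(l − i) ≤ 1∕(g_i)² ≤ 1∕(g_l)² + (b + Wγ)·(l − i)` (`FlowStep.inv_sq_telescopeH` with the floor and the ceiling).
[cite: Balaban1987RG1, (0.31) p.259] -/
theorem inv_sq_between
    (hβ : ∀ (k : ℕ) (p : Fin (k + 1) → ℝ),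
      β k p = b + ∑ i : Fin (k + 1), ρ (k - i) * min (p (Fin.last k)) (|p (Fin.last k) - p i|))
    (hρ0 : ∀ a, 0 ≤ ρ a) (hρW : ∀ n, ∑ a ∈ range n, ρ a ≤ W) {L : ℕ} {g : ℕ → ℝ} (h : RGEqH L β g)
    (hbox : ∀ k, k ≤ L → 0 < g k ∧ g k ≤ γ) {i l : ℕ} (hil : i ≤ l) (hl : l ≤ L) :
    1 / (g l) ^ 2 + b * ((l - i : ℕ) : ℝ) ≤ 1 / (g i) ^ 2
      ∧ 1 / (g i) ^ 2 ≤ 1 / (g l) ^ 2 + (b + W * γ) * ((l - i : ℕ) : ℝ) := by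
  have hlo : BetaLowerH b γ β :=
    RemainderExplicitHistoryHalfMomentWitness.lower (γ := γ) (lam := fun k i => ρ (k - i)) hβ (fun k i => hρ0 _)
  rw [inv_sq_telescopeH h hil hl]
  have hmem : ∀ j ∈ Ico i l, prefixOf g j ∈ Box γ j := fun j hj =>
    prefixOf_mem_box ((Finset.mem_Ico.mp hj).2.le.trans hl) hbox
  have hlow := Finset.card_nsmul_le_sum (Ico i l) (fun j => β j (prefixOf g j)) b fun j hj => hlo j _ (hmem j hj)
  have hup := Finset.sum_le_card_nsmul (Ico i l) (fun j => β j (prefixOf g j)) (b + W * γ)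
    fun j hj => beta_le_ceiling hβ hρ0 hρW j _ (hmem j hj)
  rw [Nat.card_Ico, nsmul_eq_mul] at hlow hup
  constructor <;> linarith

/-- THE COUPLING FROM ABOVE at infrared distance `K − j` on a box run of `K + n` steps: `g_{j+n} ≤ 1∕√(b(K−j))` for `j < K`
(`T4OneLoopAsymptotics.run_le_inv_sqrt` BY NAME). [cite: Balaban1987RG1, (0.31) p.259] -/
theorem coupling_le_inv_sqrt
    (hβ : ∀ (k : ℕ) (p : Fin (k + 1) → ℝ),
      β k p = b + ∑ i : Fin (k + 1), ρ (k - i) * min (p (Fin.last k)) (|p (Fin.last k) - p i|))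
    (hb : 0 < b) (hρ0 : ∀ a, 0 ≤ ρ a) {K n : ℕ} {g : ℕ → ℝ} (h : RGEqH (K + n) β g)
    (hbox : ∀ k, k ≤ K + n → 0 < g k ∧ g k ≤ γ) {j : ℕ} (hj : j < K) :
    g (j + n) ≤ 1 / Real.sqrt (b * ((K - j : ℕ) : ℝ)) := by
  have hlo : BetaLowerH b γ β :=
    RemainderExplicitHistoryHalfMomentWitness.lower (γ := γ) (lam := fun k i => ρ (k - i)) hβ (fun k i => hρ0 _)
  have h1 := run_le_inv_sqrt h hbox hb (eventualLowerH_of_betaLowerH hlo 0) (Nat.zero_le (j + n)) (by omega : j + n < K + n)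
  rwa [Nat.add_sub_add_right] at h1

/-- THE COUPLING FROM BELOW at infrared distance `K − j ≥ 1`: with `b₂ = 1∕(g_{K+n})² + (b + Wγ)`, `1∕√(b₂(K−j)) ≤ g_{j+n}` for `j < K`
(the ceiling half of `inv_sq_between` from `j + n` to the pin, and `1∕(g_{K+n})² ≤ (1∕(g_{K+n})²)·(K − j)`). [cite: Balaban1987RG1, (0.31) p.259] -/
theorem inv_sqrt_le_coupling
    (hβ : ∀ (k : ℕ) (p : Fin (k + 1) → ℝ),
      β k p = b + ∑ i : Fin (k + 1), ρ (k - i) * min (p (Fin.last k)) (|p (Fin.last k) - p i|))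
    (hb : 0 < b) (hγ : 0 < γ) (hρ0 : ∀ a, 0 ≤ ρ a) (hρW : ∀ n, ∑ a ∈ range n, ρ a ≤ W) {K n : ℕ} {g : ℕ → ℝ}
    (h : RGEqH (K + n) β g) (hbox : ∀ k, k ≤ K + n → 0 < g k ∧ g k ≤ γ) {j : ℕ} (hj : j < K) :
    1 / Real.sqrt ((1 / (g (K + n)) ^ 2 + (b + W * γ)) * ((K - j : ℕ) : ℝ)) ≤ g (j + n) := by
  have hW : 0 ≤ W := by simpa using hρW 0
  have hx := (hbox (j + n) (by omega)).1
  have hs1 : (1 : ℝ) ≤ ((K - j : ℕ) : ℝ) := by exact_mod_cast (show 1 ≤ K - j by omega)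
  have hup := (inv_sq_between hβ hρ0 hρW h hbox (show j + n ≤ K + n by omega) le_rfl).2
  rw [show K + n - (j + n) = K - j by omega] at hup
  set b₂ : ℝ := 1 / (g (K + n)) ^ 2 + (b + W * γ) with hb₂
  have hA0 : 0 ≤ 1 / (g (K + n)) ^ 2 := by have := (hbox (K + n) le_rfl).1; positivity
  have hb₂pos : 0 < b₂ := by rw [hb₂]; positivity
  have hx2 : 1 / (g (j + n)) ^ 2 ≤ b₂ * ((K - j : ℕ) : ℝ) := by
    rw [hb₂, add_mul]
    nlinarith
  -- `1∕√(b₂ s) ≤ x` from `1∕x² ≤ b₂ s`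
  have hbs : 0 < b₂ * ((K - j : ℕ) : ℝ) := by positivity
  have hsq : (1 / Real.sqrt (b₂ * ((K - j : ℕ) : ℝ))) ^ 2 ≤ (g (j + n)) ^ 2 := by
    rw [one_div_pow, Real.sq_sqrt hbs.le, one_div_le hbs (pow_pos hx 2)]
    exact hx2
  exact (pow_le_pow_iff_left₀ (by positivity) hx.le two_ne_zero).mp hsq

/-! ## §2 One extra age at one position: the coupling gap both ways -/

/-- **THE GAP FROM ABOVE.**  On a box run of `K + n` steps, at position `j < K` an extra age `a ≤ j + n` contributes at most
`g_{j+n} − g_{j+n−a} ≤ (1∕√(b(K−j)))·min(1, κa∕(2(K−j)))` with `κ = (b + Wγ)∕b` (`gap_le_mul_min` at `L = (b+Wγ)·a`, moved to the profile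
value `1∕√(b(K−j)) ≥ g_{j+n}` by `mul_min_mono`). [cite: Balaban1987RG1, (0.31) p.259] -/
theorem gap_le_profile_min
    (hβ : ∀ (k : ℕ) (p : Fin (k + 1) → ℝ),
      β k p = b + ∑ i : Fin (k + 1), ρ (k - i) * min (p (Fin.last k)) (|p (Fin.last k) - p i|))
    (hb : 0 < b) (hγ : 0 < γ) (hρ0 : ∀ a, 0 ≤ ρ a) (hρW : ∀ n, ∑ a ∈ range n, ρ a ≤ W) {K n : ℕ} {g : ℕ → ℝ}
    (h : RGEqH (K + n) β g) (hbox : ∀ k, k ≤ K + n → 0 < g k ∧ g k ≤ γ) {j a : ℕ} (hj : j < K) (ha : a ≤ j + n) :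
    g (j + n) - g (j + n - a)
      ≤ 1 / Real.sqrt (b * ((K - j : ℕ) : ℝ)) * min 1 ((b + W * γ) / b * a / (2 * ((K - j : ℕ) : ℝ))) := by
  have hW : 0 ≤ W := by simpa using hρW 0
  have hx := (hbox (j + n) (by omega)).1
  have hx' := (hbox (j + n - a) (by omega)).1
  have hbt := inv_sq_between hβ hρ0 hρW h hbox (show j + n - a ≤ j + n by omega) (by omega : j + n ≤ K + n)
  rw [show j + n - (j + n - a) = a by omega] at hbt
  have hL : 0 ≤ (b + W * γ) * (a : ℝ) := by positivity
  have hx'x : g (j + n - a) ≤ g (j + n) :=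
    le_of_one_div_sq_le hx hx' (by nlinarith [hbt.1, show (0:ℝ) ≤ b * a by positivity])
  have h1 := gap_le_mul_min hx' hx'x hL hbt.2
  have hs0 : (0 : ℝ) < ((K - j : ℕ) : ℝ) := by exact_mod_cast (show 0 < K - j by omega)
  have hy := coupling_le_inv_sqrt hβ hb hρ0 h hbox hj
  have h2 := mul_min_mono (c := (b + W * γ) * a / 2) (by positivity) hx.le hy
  have e1 : (b + W * γ) * (a : ℝ) * g (j + n) ^ 2 / 2 = (b + W * γ) * a / 2 * g (j + n) ^ 2 := by ring
  have e2 : (b + W * γ) * a / 2 * (1 / Real.sqrt (b * ((K - j : ℕ) : ℝ))) ^ 2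
      = (b + W * γ) / b * a / (2 * ((K - j : ℕ) : ℝ)) := by
    rw [one_div_pow, Real.sq_sqrt (by positivity)]
    field_simp
  rw [e1] at h1
  rw [e2] at h2
  exact h1.trans h2

/-- **THE GAP FROM BELOW.**  Same run and position; with `b₂ = 1∕(g_{K+n})² + (b + Wγ)` and `κ₂ = b₂∕b`:
`(1∕(8√(b₂(K−j))))·min(1, a∕(κ₂(K−j))) ≤ g_{j+n} − g_{j+n−a}` (`mul_min_le_gap` at `L = b·a`, moved down to the profile value
`1∕√(b₂(K−j)) ≤ g_{j+n}` by `mul_min_mono`). [cite: Balaban1987RG1, (0.31) p.259] -/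
theorem profile_min_le_gap
    (hβ : ∀ (k : ℕ) (p : Fin (k + 1) → ℝ),
      β k p = b + ∑ i : Fin (k + 1), ρ (k - i) * min (p (Fin.last k)) (|p (Fin.last k) - p i|))
    (hb : 0 < b) (hγ : 0 < γ) (hρ0 : ∀ a, 0 ≤ ρ a) (hρW : ∀ n, ∑ a ∈ range n, ρ a ≤ W) {K n : ℕ} {g : ℕ → ℝ}
    (h : RGEqH (K + n) β g) (hbox : ∀ k, k ≤ K + n → 0 < g k ∧ g k ≤ γ) {j a : ℕ} (hj : j < K) (ha : a ≤ j + n) :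
    1 / (8 * Real.sqrt ((1 / (g (K + n)) ^ 2 + (b + W * γ)) * ((K - j : ℕ) : ℝ)))
        * min 1 (a / ((1 / (g (K + n)) ^ 2 + (b + W * γ)) / b * ((K - j : ℕ) : ℝ)))
      ≤ g (j + n) - g (j + n - a) := by
  have hW : 0 ≤ W := by simpa using hρW 0
  have hx := (hbox (j + n) (by omega)).1
  have hx' := (hbox (j + n - a) (by omega)).1
  have hpinpos := (hbox (K + n) le_rfl).1
  have hbt := inv_sq_between hβ hρ0 hρW h hbox (show j + n - a ≤ j + n by omega) (by omega : j + n ≤ K + n)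
  rw [show j + n - (j + n - a) = a by omega] at hbt
  have hL : 0 ≤ b * (a : ℝ) := by positivity
  have h1 := mul_min_le_gap hx' hx hL hbt.1
  have hs0 : (0 : ℝ) < ((K - j : ℕ) : ℝ) := by exact_mod_cast (show 0 < K - j by omega)
  set b₂ : ℝ := 1 / (g (K + n)) ^ 2 + (b + W * γ) with hb₂
  have hb₂pos : 0 < b₂ := by rw [hb₂]; positivity
  have hz := inv_sqrt_le_coupling hβ hb hγ hρ0 hρW h hbox hj
  have hz0 : 0 ≤ 1 / Real.sqrt (b₂ * ((K - j : ℕ) : ℝ)) := by positivity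
  have h2 := mul_min_mono (c := b * a) hL hz0 hz
  have e2 : b * (a : ℝ) * (1 / Real.sqrt (b₂ * ((K - j : ℕ) : ℝ))) ^ 2 = a / (b₂ / b * ((K - j : ℕ) : ℝ)) := by
    rw [one_div_pow, Real.sq_sqrt (by positivity)]
    field_simp
  rw [e2] at h2
  have e3 : 1 / (8 * Real.sqrt (b₂ * ((K - j : ℕ) : ℝ))) * min 1 (a / (b₂ / b * ((K - j : ℕ) : ℝ)))
      = (1 / Real.sqrt (b₂ * ((K - j : ℕ) : ℝ)) * min 1 (a / (b₂ / b * ((K - j : ℕ) : ℝ)))) / 8 := by ring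
  rw [e3, div_le_iff₀ (by norm_num : (0:ℝ) < 8)]
  calc 1 / Real.sqrt (b₂ * ((K - j : ℕ) : ℝ)) * min 1 (a / (b₂ / b * ((K - j : ℕ) : ℝ)))
      ≤ g (j + n) * min 1 (b * a * g (j + n) ^ 2) := h2
    _ ≤ (g (j + n) - g (j + n - a)) * 8 := by linarith

/-! ## §3 The extra-history source, bounded both ways by `Σ_a ρ(a)·min(a,K)² ∕ (K√K)` -/

/-- Re-indexing the source by age: `Σ_{j<K} Σ_{i<n} ρ(j+n−i)·(g_{j+n} − g_i) = Σ_{a<K+n} Σ_{j<K, j+1≤a≤j+n} ρ(a)·(g_{j+n} − g_{j+n−a})`. [folklore] -/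
theorem src_eq_sum_ages (g : ℕ → ℝ) (K n : ℕ) :
    ∑ j ∈ range K, ∑ i ∈ range n, ρ (j + n - i) * (g (j + n) - g i)
      = ∑ a ∈ range (K + n), ∑ j ∈ (range K).filter (fun j => j + 1 ≤ a ∧ a ≤ j + n), ρ a * (g (j + n) - g (j + n - a)) := by
  rw [← sum_extra_ages_swap (fun a j => ρ a * (g (j + n) - g (j + n - a))) K n]
  refine Finset.sum_congr rfl fun j _ => Finset.sum_congr rfl fun i hi => ?_
  have hi' := Finset.mem_range.mp hi
  rw [show j + n - (j + n - i) = i by omega]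

/-- **THE SOURCE FROM ABOVE.**  On a box run `g` of `K + n` steps (`K ≥ 1`) of the order-0 profile family (`b > 0`, `ρ ≥ 0`, `Σ_{a<N} ρ_a ≤ W`):
`Σ_{j<K} Σ_{i<n} ρ(j+n−i)·(g_{j+n} − g_i) ≤ (8κ ∕ (K√(bK)))·Σ_{a<K+n} ρ(a)·min(a,K)²`, `κ = (b + Wγ)∕b` — young ages `a ≤ K∕2` cost `a²∕K^{3∕2}`
each (they are missing only at the `a` ultraviolet-most positions, where the couplings are `O((bK)^{−1∕2})` and an age-`a` gap is `O(a·K^{−3∕2})`),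
old ages cost `√K`. [cite: Balaban1987RG1, (0.31) p.259] -/
theorem src_le
    (hβ : ∀ (k : ℕ) (p : Fin (k + 1) → ℝ),
      β k p = b + ∑ i : Fin (k + 1), ρ (k - i) * min (p (Fin.last k)) (|p (Fin.last k) - p i|))
    (hb : 0 < b) (hγ : 0 < γ) (hρ0 : ∀ a, 0 ≤ ρ a) (hρW : ∀ n, ∑ a ∈ range n, ρ a ≤ W) {K n : ℕ} (hK : 1 ≤ K) {g : ℕ → ℝ}
    (h : RGEqH (K + n) β g) (hbox : ∀ k, k ≤ K + n → 0 < g k ∧ g k ≤ γ) :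
    ∑ j ∈ range K, ∑ i ∈ range n, ρ (j + n - i) * (g (j + n) - g i)
      ≤ 8 * ((b + W * γ) / b) / ((K : ℝ) * Real.sqrt (b * K)) * ∑ a ∈ range (K + n), ρ a * (min (a : ℝ) K) ^ 2 := by
  have hW : 0 ≤ W := by simpa using hρW 0
  have hκ : 1 ≤ (b + W * γ) / b := by rw [le_div_iff₀ hb]; nlinarith
  have hKpos : (0 : ℝ) < K := by exact_mod_cast hK
  rw [src_eq_sum_ages g K n, Finset.mul_sum]
  refine Finset.sum_le_sum fun a _ => ?_
  have hwin := window_upper_le hb hκ hK a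
  calc ∑ j ∈ (range K).filter (fun j => j + 1 ≤ a ∧ a ≤ j + n), ρ a * (g (j + n) - g (j + n - a))
      ≤ ∑ j ∈ (range K).filter (fun j => j + 1 ≤ a ∧ a ≤ j + n),
          ρ a * (1 / Real.sqrt (b * ((K - j : ℕ) : ℝ)) * min 1 ((b + W * γ) / b * a / (2 * ((K - j : ℕ) : ℝ)))) := by
        refine Finset.sum_le_sum fun j hj => mul_le_mul_of_nonneg_left ?_ (hρ0 a)
        have hj' := Finset.mem_filter.mp hj
        exact gap_le_profile_min hβ hb hγ hρ0 hρW h hbox (Finset.mem_range.mp hj'.1) (by omega)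
    _ ≤ ∑ j ∈ range (min a K),
          ρ a * (1 / Real.sqrt (b * ((K - j : ℕ) : ℝ)) * min 1 ((b + W * γ) / b * a / (2 * ((K - j : ℕ) : ℝ)))) := by
        refine Finset.sum_le_sum_of_subset_of_nonneg (filter_extra_subset K n a) fun j _ _ => ?_
        exact mul_nonneg (hρ0 a) (mul_nonneg (by positivity) (le_min zero_le_one (by positivity)))
    _ = ρ a * ∑ j ∈ range (min a K),
          1 / Real.sqrt (b * ((K - j : ℕ) : ℝ)) * min 1 ((b + W * γ) / b * a / (2 * ((K - j : ℕ) : ℝ))) := by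
        rw [Finset.mul_sum]
    _ ≤ ρ a * (8 * ((b + W * γ) / b) * (min (a : ℝ) K) ^ 2 / ((K : ℝ) * Real.sqrt (b * K))) :=
        mul_le_mul_of_nonneg_left hwin (hρ0 a)
    _ = 8 * ((b + W * γ) / b) / ((K : ℝ) * Real.sqrt (b * K)) * (ρ a * (min (a : ℝ) K) ^ 2) := by ring

/-- **THE SOURCE FROM BELOW.**  Same run (`K ≥ 1`); with `b₂ = 1∕(g_{K+n})² + (b + Wγ)`, `κ₂ = b₂∕b`, for every `N ≤ n + 1`:
`(1 ∕ (8κ₂·K√(b₂K)))·Σ_{a<N} ρ(a)·min(a,K)² ≤ Σ_{j<K} Σ_{i<n} ρ(j+n−i)·(g_{j+n} − g_i)` — the ages `a ≤ n` are missing at exactly the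
`min(a,K)` ultraviolet-most positions, where asymptotic freedom from BELOW still separates the couplings. [cite: Balaban1987RG1, (0.31) p.259] -/
theorem le_src
    (hβ : ∀ (k : ℕ) (p : Fin (k + 1) → ℝ),
      β k p = b + ∑ i : Fin (k + 1), ρ (k - i) * min (p (Fin.last k)) (|p (Fin.last k) - p i|))
    (hb : 0 < b) (hγ : 0 < γ) (hρ0 : ∀ a, 0 ≤ ρ a) (hρW : ∀ n, ∑ a ∈ range n, ρ a ≤ W) {K n : ℕ} (hK : 1 ≤ K) {g : ℕ → ℝ}
    (h : RGEqH (K + n) β g) (hbox : ∀ k, k ≤ K + n → 0 < g k ∧ g k ≤ γ) {N : ℕ} (hN : N ≤ n + 1) :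
    1 / (8 * ((1 / (g (K + n)) ^ 2 + (b + W * γ)) / b * K * Real.sqrt ((1 / (g (K + n)) ^ 2 + (b + W * γ)) * K)))
        * ∑ a ∈ range N, ρ a * (min (a : ℝ) K) ^ 2
      ≤ ∑ j ∈ range K, ∑ i ∈ range n, ρ (j + n - i) * (g (j + n) - g i) := by
  have hW : 0 ≤ W := by simpa using hρW 0
  have hpinpos := (hbox (K + n) le_rfl).1
  set b₂ : ℝ := 1 / (g (K + n)) ^ 2 + (b + W * γ) with hb₂
  have hb₂pos : 0 < b₂ := by rw [hb₂]; positivity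
  have hκ₂ : 1 ≤ b₂ / b := by
    rw [le_div_iff₀ hb, hb₂]
    have : 0 ≤ 1 / (g (K + n)) ^ 2 := by positivity
    nlinarith
  have hKpos : (0 : ℝ) < K := by exact_mod_cast hK
  -- nonnegativity of the age-`a` block
  have hF0 : ∀ a ∈ range (K + n), 0 ≤ ∑ j ∈ (range K).filter (fun j => j + 1 ≤ a ∧ a ≤ j + n), ρ a * (g (j + n) - g (j + n - a)) := by
    intro a _
    refine Finset.sum_nonneg fun j hj => mul_nonneg (hρ0 a) ?_
    have hj' := Finset.mem_filter.mp hj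
    have := profile_min_le_gap hβ hb hγ hρ0 hρW h hbox (Finset.mem_range.mp hj'.1) (show a ≤ j + n by omega)
    exact le_trans (mul_nonneg (by positivity) (le_min zero_le_one (by positivity))) this
  rw [src_eq_sum_ages g K n, Finset.mul_sum]
  calc ∑ a ∈ range N, 1 / (8 * (b₂ / b * K * Real.sqrt (b₂ * K))) * (ρ a * (min (a : ℝ) K) ^ 2)
      = ∑ a ∈ range N, ρ a / 8 * ((min (a : ℝ) K) ^ 2 / (b₂ / b * K * Real.sqrt (b₂ * K))) :=
        Finset.sum_congr rfl fun a _ => by ring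
    _ ≤ ∑ a ∈ range N, ρ a / 8 * ∑ j ∈ range (min a K),
          1 / Real.sqrt (b₂ * ((K - j : ℕ) : ℝ)) * min 1 (a / (b₂ / b * ((K - j : ℕ) : ℝ))) :=
        Finset.sum_le_sum fun a _ => mul_le_mul_of_nonneg_left (le_window_lower hb₂pos hκ₂ hK a) (by have := hρ0 a; positivity)
    _ = ∑ a ∈ range N, ∑ j ∈ range (min a K),
          ρ a * (1 / (8 * Real.sqrt (b₂ * ((K - j : ℕ) : ℝ))) * min 1 (a / (b₂ / b * ((K - j : ℕ) : ℝ)))) := by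
        refine Finset.sum_congr rfl fun a _ => ?_
        rw [Finset.mul_sum]
        refine Finset.sum_congr rfl fun j _ => ?_
        rw [show 1 / (8 * Real.sqrt (b₂ * ((K - j : ℕ) : ℝ))) = 1 / Real.sqrt (b₂ * ((K - j : ℕ) : ℝ)) / 8 by
          rw [mul_comm, ← div_div]]
        ring
    _ ≤ ∑ a ∈ range N, ∑ j ∈ range (min a K), ρ a * (g (j + n) - g (j + n - a)) := by
        refine Finset.sum_le_sum fun a ha => Finset.sum_le_sum fun j hj => mul_le_mul_of_nonneg_left ?_ (hρ0 a)
        have ha' := Finset.mem_range.mp ha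
        have hj' : j < min a K := Finset.mem_range.mp hj
        exact profile_min_le_gap hβ hb hγ hρ0 hρW h hbox (lt_of_lt_of_le hj' (min_le_right a K)) (by omega)
    _ = ∑ a ∈ range N, ∑ j ∈ (range K).filter (fun j => j + 1 ≤ a ∧ a ≤ j + n), ρ a * (g (j + n) - g (j + n - a)) := by
        refine Finset.sum_congr rfl fun a ha => ?_
        rw [filter_extra_eq (by have := Finset.mem_range.mp ha; omega : a ≤ n)]
    _ ≤ ∑ a ∈ range (K + n), ∑ j ∈ (range K).filter (fun j => j + 1 ≤ a ∧ a ≤ j + n), ρ a * (g (j + n) - g (j + n - a)) :=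
        Finset.sum_le_sum_of_subset_of_nonneg (Finset.range_mono (by omega)) fun a ha _ => hF0 a ha

end Summit.QuantumFields.BalabanUV.Beta.RemainderExplicitHistoryDiagonalSource

end
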